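import Mathlib
import Literature.AlgebraicGeometry.HodgeTheory.CartierDivisorChernClass
import Literature.Geometry.Kaehler.ChernCharacterCocycleIso
import HarnessLib

/-!
# GAGALineBundles

Topic `Literature/AlgebraicGeometry/HodgeTheory`. Named literature fact(s) relocated by the gate from `Summits/HodgeConjecture/HodgeConjecture/Theorems/NikulinTwinTransportLefschetzOneOneK3GAGA.lean`
(accept-time relocation of `[cite]`d propositions written inline in a Summits proposal; human ruling 2026-08-15).
Sources: GortzWedhorn2020, SerreGAGA1956.

* `Literature.AlgebraicGeometry.HodgeTheory.serreGAGA_lineCocycle_iso_cartierDivisorCocycle`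
-/

namespace Literature.AlgebraicGeometry.HodgeTheory

open scoped Manifold ContDiff
open Literature.Geometry.Kaehler
open Literature.AlgebraicGeometry
open Literature.AlgebraicGeometry.HodgeTheory

/-- **GAGA for line bundles** (J.-P. Serre, *Géométrie algébrique et géométrie analytique* (1956),
n° 20 Prop. 18: for `X` projective over `ℂ` the map `H¹(X, 𝒢) → H¹(X^h, 𝒢^h)`, `𝒢 = GL_r(𝒪_X)`, is
bijective — every holomorphic vector bundle on `X^h` is the analytification of an algebraic one, uniquely;
here `r = 1` and surjectivity only), combined with `Pic X = CaCl X` for `X` integral (every algebraic line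
bundle is `𝒪_X(D)` for a Cartier divisor `D`; Görtz–Wedhorn I, Prop. 11.21). In the tree's vocabulary:
for `X` smooth projective over `ℂ` with Hodge model `A` (`A.carrier ≅ X^an`), every HOLOMORPHIC rank-one
cocycle `V` on `A.carrier` (`SmoothComplexVectorBundle ι A.model A.carrier 1`, `V.IsHolomorphic`) is
holomorphically isomorphic, as a cocycle-presented bundle (`SmoothComplexVectorBundle.CocycleIso`,
Fritzsche–Grauert IV §2 condition (C); `CocycleIso.IsHolomorphic`), to the analytified line bundle
`𝒪_X(D)^an = cartierDivisorCocycle A.isAnalytification D` of some Cartier divisor `D` on `X`.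
[cite: SerreGAGA1956, n° 20 Prop. 18 and n° 12 Thm. 3] [cite: GortzWedhorn2020, Prop. 11.21 (p. 374)]
[file AlgebraicGeometry/HodgeTheory/GAGALineBundles] -/
def serreGAGA_lineCocycle_iso_cartierDivisorCocycle : Prop :=
  ∀ ⦃n : ℕ⦄ ⦃X : Literature.AlgebraicGeometry.Motives.SchemeOver ℂ⦄
    (hX : Literature.AlgebraicGeometry.Motives.IsSmoothProjective n X)
    (A : Literature.AlgebraicGeometry.HodgeTheory.HodgeModel n X) (ι : Type)
    (V : Literature.Geometry.Kaehler.SmoothComplexVectorBundle ι A.model A.carrier 1), V.IsHolomorphic →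
    letI : AlgebraicGeometry.IsIntegral X.left :=
      Literature.AlgebraicGeometry.Motives.IsSmoothProjective.isIntegral_holds hX
    ∃ (D : Literature.AlgebraicGeometry.Motives.CartierDivisor X.left)
      (Φ : Literature.Geometry.Kaehler.SmoothComplexVectorBundle.CocycleIso V
        (Literature.AlgebraicGeometry.HodgeTheory.cartierDivisorCocycle A.isAnalytification D)),
      Φ.IsHolomorphic

end Literature.AlgebraicGeometry.HodgeTheory
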